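import Literature.Computability.AlgebraicComplexity.QuantumFunctionalsUpperMonotone
import HarnessLib

/-!
# Sub-multiplicativity of the upper quantum functional (CVZ Lemma 3.13): the printed proof,
# reduced to Schur–Weyl duality, the Kronecker restriction rule and Lemma 3.10.1

Topic `Literature/Computability/AlgebraicComplexity`; decomposition file (layer 2 of the deep half)
under the named fact `ChristandlVranaZuiddam2023_upper_submultiplicative`
(`QuantumFunctionalsUpper.lean`; Christandl–Vrana–Zuiddam, J. Amer. Math. Soc. 36 (2023),
Lemma 3.13: `F^θ(s ⊗ t) ≤ F^θ(s) F^θ(t)` for the upper quantum functional `F^θ` of Def. 3.3 and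
`θ ∈ P_nc(B)`, for `k = 3` all of `P([3])`).

The printed proof of Lemma 3.13 (p. 14 of arXiv:1709.07851v3) is five lines long but rests on
three pieces of representation theory of the symmetric group, none of which is in Mathlib and all
of which sit on top of the (unproved) named facts of `SymmetricGroupReps.lean` (irreducibility,
distinctness and completeness of the complex Specht modules):

* **(sw)** the isotypic decomposition `V^{⊗n} = ⊕_{λ ⊢ n} P_λ^V V^{⊗n}`, i.e. `∑_λ P_λ^V = id` with
  `P_λ^V = (dim[λ]/n!) ∑_{π ∈ S_n} χ_λ(π) π` (CVZ §3.1 display (sw); Fulton–Harris (2.32) with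
  Thm. 4.3) — used in the first display of the proof,
  `s^{⊗n} ⊗ t^{⊗n} = ∑_{μ,ν} (∏_b P_{μ^{(b)}} s^{⊗n}) ⊗ (∏_b P_{ν^{(b)}} t^{⊗n})`;
* **(kr)** the Kronecker restriction rule, the sentence printed before Lemma 3.13: "The projections
  `P_λ^{V⊗W}` and `P_μ^V ⊗ P_ν^W` commute, and their product is nonzero if and only if the
  Kronecker coefficient `g_{λ,μ,ν}` is nonzero" (only `⇒` is used);
* **(dim) = Lemma 3.10.1**: `g_{λ,μ,ν} ≠ 0 ⇒ H(λ̄) ≤ H(μ̄) + H(ν̄)` (proved in the source from the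
  semigroup property of the Kronecker coefficients, Rem. 3.9, and the hook-length dimension
  bounds of Rem. 3.7).

This file VENDORS these three printed statements as named facts, in the coordinates of
`QuantumFunctionalsUpper.lean` (unnormalised character sums `isotypicSumⱼ λ = ∑_π χ_λ(π) (π ·ⱼ –)`,
which are `n!/dim[λ]` times the projectors `P_λ^{V_j}`, so that all three statements are invariant
under this rescaling), and PROVES the text of the printed proof:

* `UpperAdmissible.exists_kronecker` — displays (ee1)–(ee3): an admissible tuple `λ⃗` for `s ⊗ t`
  yields admissible tuples `μ⃗` for `s` and `ν⃗` for `t` with `g_{λⱼ,μⱼ,νⱼ} ≠ 0` on `supp θ`;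
* `upperLogQuantumFunctional_kroneckerTensor_le` — `E^θ(s ⊗ t) ≤ E^θ(s) + E^θ(t)`;
* `ChristandlVranaZuiddam2023_upper_submultiplicative_of_schurWeyl` — Lemma 3.13 from the four
  named facts (sw), (kr), (dim) and the Schur–Weyl vanishing `schurWeyl_isotypicSum_eq_zero` of
  `QuantumFunctionalsUpper.lean` (the latter makes the supremum `E^θ(s)` a supremum over a bounded
  set, which the source uses tacitly in "(ee2) and (ee3) ⇒ at most `E^θ(s) + E^θ(t)`").

## Coordinates

For `u ∈ (V₁⊗V₂⊗V₃)^{⊗n}` and `v ∈ (W₁⊗W₂⊗W₃)^{⊗n}` in coordinates (`u : (Fin n → ι) → (Fin n → κ)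
→ (Fin n → μ) → ℂ`), `outerPow u v` is `u ⊗ v` read in `((V₁⊗W₁)⊗(V₂⊗W₂)⊗(V₃⊗W₃))^{⊗n}`, i.e. on
index types `Fin n → ι × ι'` etc.; `kroneckerPow_kroneckerTensor` is the regrouping
`(s ⊗ t)^{⊗n} = s^{⊗n} ⊗ t^{⊗n}` of the proof. The leg action `π ·ⱼ (u ⊗ v) = (π ·ⱼ u) ⊗ (π ·ⱼ v)`
is the diagonal one, so `isotypicSumⱼ λ (outerPow u v)` is (a nonzero multiple of)
`P_λ^{(V⊗W)_j} (u ⊗ v)` for the diagonally embedded `S_n → S_n × S_n` of Def. 3.8.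
The Kronecker coefficient `g_{λ,μ,ν}` of CVZ Def. 3.8 (multiplicity of `[λ]` in `[μ] ⊗ [ν]`) is the
tree's `kroneckerCoeff ℂ μ ν λ = dim Hom_{S_n}(S^μ ⊗ S^ν, S^λ)` (`SymmetricGroupReps.lean`; Specht
modules `S^λ = ℂ[S_n] a_λ b_λ` of the canonical row tableau, so `S^{(n)}` is the trivial module, the
labelling of the source).

Imports `QuantumFunctionalsUpperMonotone.lean` only for `upperLogQuantumFunctional_nonneg`
(`E^θ ≥ 0`, the nonnegativity needed by `Real.sSup_le`).

## What is NOT here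

No proof of (sw), (kr), (dim) or of the Schur–Weyl vanishing: they are the next layer of the
decomposition (see the unit's `NOTES.md`: (sw)/(kr) need the character theory of `S_n` over `ℂ`,
(dim) the semigroup property of Kronecker coefficients).

## Source

M. Christandl, P. Vrana, J. Zuiddam, *Universal points in the asymptotic spectrum of tensors*,
J. Amer. Math. Soc. 36 (2023) 31–79 = arXiv:1709.07851v3, §3.1: display (sw) and Def. 3.3
(pp. 11–12), Rem. 3.7, Def. 3.8, Rem. 3.9, Lemma 3.10 (p. 13), the paragraph before Lemma 3.13 and
Lemma 3.13 with its proof (p. 14). W. Fulton, J. Harris, *Representation Theory*, GTM 129,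
§2.4 (2.31)–(2.32) (isotypic projectors) and Thm. 4.3 (Specht modules).
-/

noncomputable section

open scoped BigOperators

namespace Literature.Computability.AlgebraicComplexity

open Literature.NumberTheory.DiophantineGeometry (spechtCharacter kroneckerCoeff)

universe u

/-! ## Outer products `u ⊗ v` of tensor powers, in product coordinates -/

section Outer

variable {K : Type*} {ι κ μ ι' κ' μ' : Type*} {n : ℕ}

/-- The **outer (tensor) product** of `u ∈ (V₁⊗V₂⊗V₃)^{⊗n}` and `v ∈ (W₁⊗W₂⊗W₃)^{⊗n}` read as an
element of `((V₁⊗W₁)⊗(V₂⊗W₂)⊗(V₃⊗W₃))^{⊗n}`: in coordinates, on index types `Fin n → ι × ι'` etc.,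
`(u ⊗ v)(a, b, c) = u(a₁, b₁, c₁) v(a₂, b₂, c₂)` with `a₁ = fst ∘ a`, `a₂ = snd ∘ a`. This is the
regrouping `s^{⊗n} ⊗ t^{⊗n} ∈ ((V⊗W)_{[k]})^{⊗n}` of the proof of CVZ Lemma 3.13.
[cite: ChristandlVranaZuiddam2023, Lemma 3.13 (proof)] -/
def outerPow [Mul K] (u : (Fin n → ι) → (Fin n → κ) → (Fin n → μ) → K)
    (v : (Fin n → ι') → (Fin n → κ') → (Fin n → μ') → K) :
    (Fin n → ι × ι') → (Fin n → κ × κ') → (Fin n → μ × μ') → K :=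
  fun a b c => u (Prod.fst ∘ a) (Prod.fst ∘ b) (Prod.fst ∘ c) *
    v (Prod.snd ∘ a) (Prod.snd ∘ b) (Prod.snd ∘ c)

/-- Entries of the outer product. [folklore] -/
@[simp] theorem outerPow_apply [Mul K] (u : (Fin n → ι) → (Fin n → κ) → (Fin n → μ) → K)
    (v : (Fin n → ι') → (Fin n → κ') → (Fin n → μ') → K) (a : Fin n → ι × ι') (b : Fin n → κ × κ')
    (c : Fin n → μ × μ') :
    outerPow u v a b c = u (Prod.fst ∘ a) (Prod.fst ∘ b) (Prod.fst ∘ c) *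
      v (Prod.snd ∘ a) (Prod.snd ∘ b) (Prod.snd ∘ c) := rfl

/-- **`(s ⊗ t)^{⊗n} = s^{⊗n} ⊗ t^{⊗n}`** (regrouping of tensor legs; first line of the proof of
CVZ Lemma 3.13). [cite: ChristandlVranaZuiddam2023, Lemma 3.13 (proof)] -/
theorem kroneckerPow_kroneckerTensor [CommSemiring K] (s : ι → κ → μ → K) (t : ι' → κ' → μ' → K)
    (n : ℕ) : kroneckerPow (kroneckerTensor s t) n = outerPow (kroneckerPow s n) (kroneckerPow t n) := by
  funext a b c
  simp only [kroneckerPow_apply, kroneckerTensor_apply, outerPow_apply, Function.comp_apply,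
    Finset.prod_mul_distrib]

/-- `0 ⊗ v = 0`. [folklore] -/
@[simp] theorem outerPow_zero_left [MulZeroClass K] (v : (Fin n → ι') → (Fin n → κ') → (Fin n → μ') → K) :
    outerPow (0 : (Fin n → ι) → (Fin n → κ) → (Fin n → μ) → K) v = 0 := by
  funext a b c
  simp [outerPow]

/-- `u ⊗ 0 = 0`. [folklore] -/
@[simp] theorem outerPow_zero_right [MulZeroClass K] (u : (Fin n → ι) → (Fin n → κ) → (Fin n → μ) → K) :
    outerPow u (0 : (Fin n → ι') → (Fin n → κ') → (Fin n → μ') → K) = 0 := by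
  funext a b c
  simp [outerPow]

/-- `u ⊗ v` is linear in `u`. [folklore] -/
theorem isLinearMap_outerPow_left [CommSemiring K] (v : (Fin n → ι') → (Fin n → κ') → (Fin n → μ') → K) :
    IsLinearMap K fun u : (Fin n → ι) → (Fin n → κ) → (Fin n → μ) → K => outerPow u v :=
  ⟨fun u u' => by funext a b c; simp [outerPow, add_mul],
    fun z u => by funext a b c; simp [outerPow, mul_assoc]⟩

/-- `u ⊗ v` is linear in `v`. [folklore] -/
theorem isLinearMap_outerPow_right [CommSemiring K] (u : (Fin n → ι) → (Fin n → κ) → (Fin n → μ) → K) :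
    IsLinearMap K fun v : (Fin n → ι') → (Fin n → κ') → (Fin n → μ') → K => outerPow u v :=
  ⟨fun v v' => by funext a b c; simp [outerPow, mul_add],
    fun z v => by funext a b c; simp [outerPow, mul_left_comm]⟩

/-- Composition of maps satisfying `IsLinearMap` (Mathlib has the bundled form only). [folklore] -/
theorem isLinearMap_comp {R M M₂ M₃ : Type*} [Semiring R] [AddCommMonoid M] [AddCommMonoid M₂]
    [AddCommMonoid M₃] [Module R M] [Module R M₂] [Module R M₃] {g : M₂ → M₃} {f : M → M₂}
    (hg : IsLinearMap R g) (hf : IsLinearMap R f) : IsLinearMap R fun x => g (f x) :=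
  ⟨fun x y => by rw [hf.map_add, hg.map_add], fun c x => by rw [hf.map_smul, hg.map_smul]⟩

end Outer

/-! ## Algebra of the isotypic character sums: entries, linearity, commutation -/

section IsotypicAlgebra

variable {ι κ μ : Type*} {n : ℕ}

/-- Entries of `isotypicSum₁`: `(∑_π χ_λ(π) π ·₁ u)(a,b,c) = ∑_π χ_λ(π) u(a ∘ π, b, c)`. [folklore] -/
theorem isotypicSum₁_apply (lam : Nat.Partition n) (u : (Fin n → ι) → (Fin n → κ) → (Fin n → μ) → ℂ)
    (a : Fin n → ι) (b : Fin n → κ) (c : Fin n → μ) :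
    isotypicSum₁ lam u a b c = ∑ π : Equiv.Perm (Fin n), spechtCharacter ℂ lam π * u (a ∘ π) b c := by
  simp [isotypicSum₁, Finset.sum_apply]

/-- Entries of `isotypicSum₂`. [folklore] -/
theorem isotypicSum₂_apply (lam : Nat.Partition n) (u : (Fin n → ι) → (Fin n → κ) → (Fin n → μ) → ℂ)
    (a : Fin n → ι) (b : Fin n → κ) (c : Fin n → μ) :
    isotypicSum₂ lam u a b c = ∑ π : Equiv.Perm (Fin n), spechtCharacter ℂ lam π * u a (b ∘ π) c := by
  simp [isotypicSum₂, Finset.sum_apply]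

/-- Entries of `isotypicSum₃`. [folklore] -/
theorem isotypicSum₃_apply (lam : Nat.Partition n) (u : (Fin n → ι) → (Fin n → κ) → (Fin n → μ) → ℂ)
    (a : Fin n → ι) (b : Fin n → κ) (c : Fin n → μ) :
    isotypicSum₃ lam u a b c = ∑ π : Equiv.Perm (Fin n), spechtCharacter ℂ lam π * u a b (c ∘ π) := by
  simp [isotypicSum₃, Finset.sum_apply]

/-- `isotypicSum₁ λ` is `ℂ`-linear. [folklore] -/
theorem isLinearMap_isotypicSum₁ (lam : Nat.Partition n) :
    IsLinearMap ℂ (isotypicSum₁ (ι := ι) (κ := κ) (μ := μ) lam) :=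
  ⟨fun u v => by funext a b c; simp [isotypicSum₁_apply, mul_add, Finset.sum_add_distrib],
    fun z u => by funext a b c; simp [isotypicSum₁_apply, Finset.mul_sum, mul_left_comm]⟩

/-- `isotypicSum₂ λ` is `ℂ`-linear. [folklore] -/
theorem isLinearMap_isotypicSum₂ (lam : Nat.Partition n) :
    IsLinearMap ℂ (isotypicSum₂ (ι := ι) (κ := κ) (μ := μ) lam) :=
  ⟨fun u v => by funext a b c; simp [isotypicSum₂_apply, mul_add, Finset.sum_add_distrib],
    fun z u => by funext a b c; simp [isotypicSum₂_apply, Finset.mul_sum, mul_left_comm]⟩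

/-- `isotypicSum₃ λ` is `ℂ`-linear. [folklore] -/
theorem isLinearMap_isotypicSum₃ (lam : Nat.Partition n) :
    IsLinearMap ℂ (isotypicSum₃ (ι := ι) (κ := κ) (μ := μ) lam) :=
  ⟨fun u v => by funext a b c; simp [isotypicSum₃_apply, mul_add, Finset.sum_add_distrib],
    fun z u => by funext a b c; simp [isotypicSum₃_apply, Finset.mul_sum, mul_left_comm]⟩

/-- Isotypic sums on different factors commute (CVZ Lemma 3.2: the projectors `P^{V_{b₁}}`,
`P^{V_{b₂}}` of non-crossing bipartitions commute). [cite: ChristandlVranaZuiddam2023, Lemma 3.2] -/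
theorem isotypicSum₁_isotypicSum₂ (lam lam' : Nat.Partition n)
    (u : (Fin n → ι) → (Fin n → κ) → (Fin n → μ) → ℂ) :
    isotypicSum₁ lam (isotypicSum₂ lam' u) = isotypicSum₂ lam' (isotypicSum₁ lam u) := by
  funext a b c
  simp only [isotypicSum₁_apply, isotypicSum₂_apply, Finset.mul_sum]
  rw [Finset.sum_comm]
  exact Finset.sum_congr rfl fun σ _ => Finset.sum_congr rfl fun π _ => by ring

/-- Isotypic sums on factors 1 and 3 commute. [cite: ChristandlVranaZuiddam2023, Lemma 3.2] -/
theorem isotypicSum₁_isotypicSum₃ (lam lam' : Nat.Partition n)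
    (u : (Fin n → ι) → (Fin n → κ) → (Fin n → μ) → ℂ) :
    isotypicSum₁ lam (isotypicSum₃ lam' u) = isotypicSum₃ lam' (isotypicSum₁ lam u) := by
  funext a b c
  simp only [isotypicSum₁_apply, isotypicSum₃_apply, Finset.mul_sum]
  rw [Finset.sum_comm]
  exact Finset.sum_congr rfl fun σ _ => Finset.sum_congr rfl fun π _ => by ring

/-- Isotypic sums on factors 2 and 3 commute. [cite: ChristandlVranaZuiddam2023, Lemma 3.2] -/
theorem isotypicSum₂_isotypicSum₃ (lam lam' : Nat.Partition n)
    (u : (Fin n → ι) → (Fin n → κ) → (Fin n → μ) → ℂ) :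
    isotypicSum₂ lam (isotypicSum₃ lam' u) = isotypicSum₃ lam' (isotypicSum₂ lam u) := by
  funext a b c
  simp only [isotypicSum₂_apply, isotypicSum₃_apply, Finset.mul_sum]
  rw [Finset.sum_comm]
  exact Finset.sum_congr rfl fun σ _ => Finset.sum_congr rfl fun π _ => by ring

/-- The isotypic character sum on the legs of factor `j ∈ [3]` (`j = 0, 1, 2` for the source's
`b = {1},{2},{3}`): `legIsotypicSum j λ = isotypicSum₁ λ / isotypicSum₂ λ / isotypicSum₃ λ`, a nonzero
multiple of the projector `P_λ^{V_b}` of CVZ §3.1. [cite: ChristandlVranaZuiddam2023, §3.1] -/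
def legIsotypicSum (j : Fin 3) (lam : Nat.Partition n)
    (u : (Fin n → ι) → (Fin n → κ) → (Fin n → μ) → ℂ) : (Fin n → ι) → (Fin n → κ) → (Fin n → μ) → ℂ :=
  ![isotypicSum₁ lam u, isotypicSum₂ lam u, isotypicSum₃ lam u] j

/-- `legIsotypicSum 0 = isotypicSum₁`. [folklore] -/
@[simp] theorem legIsotypicSum_zero (lam : Nat.Partition n)
    (u : (Fin n → ι) → (Fin n → κ) → (Fin n → μ) → ℂ) : legIsotypicSum 0 lam u = isotypicSum₁ lam u :=
  rfl

/-- `legIsotypicSum 1 = isotypicSum₂`. [folklore] -/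
@[simp] theorem legIsotypicSum_one (lam : Nat.Partition n)
    (u : (Fin n → ι) → (Fin n → κ) → (Fin n → μ) → ℂ) : legIsotypicSum 1 lam u = isotypicSum₂ lam u :=
  rfl

/-- `legIsotypicSum 2 = isotypicSum₃`. [folklore] -/
@[simp] theorem legIsotypicSum_two (lam : Nat.Partition n)
    (u : (Fin n → ι) → (Fin n → κ) → (Fin n → μ) → ℂ) : legIsotypicSum 2 lam u = isotypicSum₃ lam u :=
  rfl

/-- The leg isotypic sums kill `0`. [folklore] -/
@[simp] theorem legIsotypicSum_map_zero (j : Fin 3) (lam : Nat.Partition n) :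
    legIsotypicSum j lam (0 : (Fin n → ι) → (Fin n → κ) → (Fin n → μ) → ℂ) = 0 := by
  fin_cases j <;> simp [legIsotypicSum]

/-- The leg isotypic sums are `ℂ`-linear. [folklore] -/
theorem isLinearMap_legIsotypicSum (j : Fin 3) (lam : Nat.Partition n) :
    IsLinearMap ℂ (legIsotypicSum (ι := ι) (κ := κ) (μ := μ) j lam) := by
  fin_cases j
  · exact isLinearMap_isotypicSum₁ lam
  · exact isLinearMap_isotypicSum₂ lam
  · exact isLinearMap_isotypicSum₃ lam

end IsotypicAlgebra

/-! ## The three named facts: (sw), the Kronecker restriction rule, Lemma 3.10.1 -/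

section Facts

/-- **Isotypic decomposition of tensor powers (Schur–Weyl duality, CVZ §3.1 (sw))**:
`V^{⊗n} ≅ ⊕_{λ ⊢ n} S_λ(V) ⊗ [λ]` and `P_λ^V` is the equivariant projection onto the `λ`-summand, so
`∑_{λ ⊢ n} P_λ^V = id`; by Fulton–Harris (2.32) (with Thm. 4.3: the `[λ] = S^λ`, `λ ⊢ n`, are the
irreducible `S_n`-modules) `P_λ^V = (dim[λ]/n!) ∑_{π ∈ S_n} χ_λ(π⁻¹) π`, and `χ_λ(π⁻¹) = χ_λ(π)` on
`S_n`. In the coordinates of `QuantumFunctionalsUpper.lean` (`dim[λ] = χ_λ(1)`), for each of the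
three leg actions: `∑_{λ ⊢ n} (χ_λ(1)/n!) • isotypicSumⱼ λ u = u` for every `u`.
[cite: ChristandlVranaZuiddam2023, §3.1 (sw)] -/
def sum_isotypicSum_eq_self : Prop :=
  ∀ {ι κ μ : Type u} [Fintype ι] [Fintype κ] [Fintype μ] {n : ℕ}
    (u : (Fin n → ι) → (Fin n → κ) → (Fin n → μ) → ℂ),
    (∑ lam : Nat.Partition n,
        (spechtCharacter ℂ lam 1 / (n.factorial : ℂ)) • isotypicSum₁ lam u = u) ∧
    (∑ lam : Nat.Partition n,
        (spechtCharacter ℂ lam 1 / (n.factorial : ℂ)) • isotypicSum₂ lam u = u) ∧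
    (∑ lam : Nat.Partition n,
        (spechtCharacter ℂ lam 1 / (n.factorial : ℂ)) • isotypicSum₃ lam u = u)

/-- **Kronecker restriction rule (CVZ §3.1, the paragraph before Lemma 3.13, direction `⇒`)**:
"The tensor power `(V⊗W)^{⊗n}` is both a `GL(V) × GL(W)`-module and a `GL(V⊗W)`-module. Let
`λ ⊢ n`, `μ ⊢ n`, `ν ⊢ n`. The projections `P_λ^{V⊗W}` and `P_μ^V ⊗ P_ν^W` commute, and their product
is nonzero if and only if the Kronecker coefficient `g_{λ,μ,ν}` is nonzero" — here `g_{λ,μ,ν}` is the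
multiplicity of `[λ]` in `[μ] ⊗ [ν]` restricted to the diagonal `S_n` (Def. 3.8), the tree's
`kroneckerCoeff ℂ μ ν λ = dim Hom_{S_n}(S^μ ⊗ S^ν, S^λ)`. In coordinates (pure tensors `u ⊗ v` span,
and the leg action on `outerPow u v` is the diagonal one), for each factor `j`: if
`isotypicSumⱼ λ (isotypicSumⱼ μ u ⊗ isotypicSumⱼ ν v) ≠ 0` for some `u ∈ (V_{[3]})^{⊗n}`,
`v ∈ (W_{[3]})^{⊗n}`, then `g_{λ,μ,ν} ≠ 0`.
[cite: ChristandlVranaZuiddam2023, §3.1 (before Lemma 3.13)] -/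
def kroneckerCoeff_ne_zero_of_isotypicSum_outerPow : Prop :=
  ∀ {ι κ μ ι' κ' μ' : Type u} [Fintype ι] [Fintype κ] [Fintype μ] [Fintype ι'] [Fintype κ']
    [Fintype μ'] {n : ℕ} (lam mu nu : Nat.Partition n)
    (u : (Fin n → ι) → (Fin n → κ) → (Fin n → μ) → ℂ)
    (v : (Fin n → ι') → (Fin n → κ') → (Fin n → μ') → ℂ),
    (isotypicSum₁ lam (outerPow (isotypicSum₁ mu u) (isotypicSum₁ nu v)) ≠ 0 →
      kroneckerCoeff ℂ mu nu lam ≠ 0) ∧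
    (isotypicSum₂ lam (outerPow (isotypicSum₂ mu u) (isotypicSum₂ nu v)) ≠ 0 →
      kroneckerCoeff ℂ mu nu lam ≠ 0) ∧
    (isotypicSum₃ lam (outerPow (isotypicSum₃ mu u) (isotypicSum₃ nu v)) ≠ 0 →
      kroneckerCoeff ℂ mu nu lam ≠ 0)

/-- **CVZ Lemma 3.10.1 (entropy inequality for Kronecker coefficients)**: for partitions
`λ, μ, ν ⊢ n`, if the Kronecker coefficient `g_{λ,μ,ν}` (multiplicity of `[λ]` in `[μ] ⊗ [ν]`,
Def. 3.8; the tree's `kroneckerCoeff ℂ μ ν λ`) is nonzero, then `H(λ̄) ≤ H(μ̄) + H(ν̄)` for the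
Shannon entropies of the normalised partitions (`partitionEntropy`, in bits; the inequality is
base-free). Printed proof: semigroup property `g_{Nλ,Nμ,Nν} ≠ 0` (Rem. 3.9), hence
`dim[Nλ] ≤ dim[Nμ] dim[Nν]`, and the dimension bounds (3.7) as `N → ∞`; the source attributes the
statement to Christandl–Mitchison (CMP 2006). [cite: ChristandlVranaZuiddam2023, Lemma 3.10.1] -/
def ChristandlVranaZuiddam2023_entropy_le_of_kroneckerCoeff : Prop :=
  ∀ {n : ℕ} (lam mu nu : Nat.Partition n), kroneckerCoeff ℂ mu nu lam ≠ 0 →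
    partitionEntropy lam ≤ partitionEntropy mu + partitionEntropy nu

/-- The Kronecker restriction rule, uniformly in the factor `j ∈ [3]`.
[cite: ChristandlVranaZuiddam2023, §3.1 (before Lemma 3.13)] -/
theorem kroneckerCoeff_ne_zero_of_legIsotypicSum (hKR : kroneckerCoeff_ne_zero_of_isotypicSum_outerPow.{u})
    {ι κ μ ι' κ' μ' : Type u} [Fintype ι] [Fintype κ] [Fintype μ] [Fintype ι'] [Fintype κ']
    [Fintype μ'] {n : ℕ} (j : Fin 3) {lam mu nu : Nat.Partition n}
    {u : (Fin n → ι) → (Fin n → κ) → (Fin n → μ) → ℂ}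
    {v : (Fin n → ι') → (Fin n → κ') → (Fin n → μ') → ℂ}
    (h : legIsotypicSum j lam (outerPow (legIsotypicSum j mu u) (legIsotypicSum j nu v)) ≠ 0) :
    kroneckerCoeff ℂ mu nu lam ≠ 0 := by
  fin_cases j
  · exact (hKR lam mu nu u v).1 h
  · exact (hKR lam mu nu u v).2.1 h
  · exact (hKR lam mu nu u v).2.2 h

end Facts

/-! ## The upper projection factor by factor -/

section Projection

variable {ι κ μ : Type u} {n : ℕ}

/-- `upperProjection θ λ⃗` is `ℂ`-linear. [folklore] -/
theorem isLinearMap_upperProjection (θ : Fin 3 → ℝ) (lam : Fin 3 → Nat.Partition n) :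
    IsLinearMap ℂ (upperProjection (ι := ι) (κ := κ) (μ := μ) θ lam) := by
  have hid : IsLinearMap ℂ (fun u : (Fin n → ι) → (Fin n → κ) → (Fin n → μ) → ℂ => u) :=
    ⟨fun _ _ => rfl, fun _ _ => rfl⟩
  have h3 : IsLinearMap ℂ (fun u : (Fin n → ι) → (Fin n → κ) → (Fin n → μ) → ℂ =>
      if θ 2 = 0 then u else isotypicSum₃ (lam 2) u) := by
    split_ifs
    exacts [hid, isLinearMap_isotypicSum₃ _]
  have h2 : IsLinearMap ℂ (fun u : (Fin n → ι) → (Fin n → κ) → (Fin n → μ) → ℂ =>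
      if θ 1 = 0 then u else isotypicSum₂ (lam 1) u) := by
    split_ifs
    exacts [hid, isLinearMap_isotypicSum₂ _]
  have h1 : IsLinearMap ℂ (fun u : (Fin n → ι) → (Fin n → κ) → (Fin n → μ) → ℂ =>
      if θ 0 = 0 then u else isotypicSum₁ (lam 0) u) := by
    split_ifs
    exacts [hid, isLinearMap_isotypicSum₁ _]
  have h := isLinearMap_comp h1 (isLinearMap_comp h2 h3)
  exact h

/-- For `j ∈ supp θ`, the upper projection factors as `P^{V_j}_{λⱼ}` after the projections of the
other factors: `upperProjection θ λ⃗ = isotypicSumⱼ λⱼ ∘ upperProjection θ[j ↦ 0] λ⃗` (the operators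
commute, CVZ Lemma 3.2). [cite: ChristandlVranaZuiddam2023, Lemma 3.2] -/
theorem upperProjection_eq_legIsotypicSum_comp {θ : Fin 3 → ℝ} {j : Fin 3} (hj : θ j ≠ 0)
    (lam : Fin 3 → Nat.Partition n) (u : (Fin n → ι) → (Fin n → κ) → (Fin n → μ) → ℂ) :
    upperProjection θ lam u =
      legIsotypicSum j (lam j) (upperProjection (Function.update θ j 0) lam u) := by
  match j with
  | 0 =>
    simp [upperProjection, hj]
  | 1 =>
    have h01 : (0 : Fin 3) ≠ 1 := by decide
    have h21 : (2 : Fin 3) ≠ 1 := by decide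
    simp only [upperProjection, legIsotypicSum_one, Function.update_self,
      Function.update_of_ne h01, Function.update_of_ne h21, hj, if_false, if_true]
    split_ifs <;>
      simp only [isotypicSum₁_isotypicSum₂, isotypicSum₁_isotypicSum₃, isotypicSum₂_isotypicSum₃]
  | 2 =>
    have h02 : (0 : Fin 3) ≠ 2 := by decide
    have h12 : (1 : Fin 3) ≠ 2 := by decide
    simp only [upperProjection, legIsotypicSum_two, Function.update_self,
      Function.update_of_ne h02, Function.update_of_ne h12, hj, if_false, if_true]
    split_ifs <;>
      simp only [isotypicSum₁_isotypicSum₂, isotypicSum₁_isotypicSum₃, isotypicSum₂_isotypicSum₃]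

/-- For `j ∉ supp θ'`, the isotypic sum on factor `j` commutes with `upperProjection θ'` (CVZ
Lemma 3.2). [cite: ChristandlVranaZuiddam2023, Lemma 3.2] -/
theorem legIsotypicSum_upperProjection_comm {θ' : Fin 3 → ℝ} {j : Fin 3} (hj : θ' j = 0)
    (l : Nat.Partition n) (lam : Fin 3 → Nat.Partition n)
    (u : (Fin n → ι) → (Fin n → κ) → (Fin n → μ) → ℂ) :
    legIsotypicSum j l (upperProjection θ' lam u) = upperProjection θ' lam (legIsotypicSum j l u) := by
  match j with
  | 0 =>
    simp only [upperProjection, legIsotypicSum_zero, hj, if_true]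
    split_ifs <;>
      simp only [isotypicSum₁_isotypicSum₂, isotypicSum₁_isotypicSum₃, isotypicSum₂_isotypicSum₃]
  | 1 =>
    simp only [upperProjection, legIsotypicSum_one, hj, if_true]
    split_ifs <;>
      simp only [isotypicSum₁_isotypicSum₂, isotypicSum₁_isotypicSum₃, isotypicSum₂_isotypicSum₃]
  | 2 =>
    simp only [upperProjection, legIsotypicSum_two, hj, if_true]
    split_ifs <;>
      simp only [isotypicSum₁_isotypicSum₂, isotypicSum₁_isotypicSum₃, isotypicSum₂_isotypicSum₃]

end Projection

/-! ## The printed proof of Lemma 3.13 -/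

section Proof

variable {ι κ μ ι' κ' μ' : Type u} [Fintype ι] [Fintype κ] [Fintype μ] [Fintype ι'] [Fintype κ']
  [Fintype μ']

/-- **(sw) ⇒ peeling one factor**: if a linear functional of `u` is nonzero, it is nonzero on some
isotypic component `P_λ^{V_j} u` (`u = ∑_λ P_λ^{V_j} u`). With `θ j = 0` the factor is skipped, as in
Def. 3.3. [cite: ChristandlVranaZuiddam2023, §3.1 (sw)] -/
theorem exists_legIsotypicSum_ne_zero (hC : sum_isotypicSum_eq_self.{u}) {n : ℕ} (θj : ℝ) (j : Fin 3)
    {X : Type*} [AddCommGroup X] [Module ℂ X]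
    {Ψ : ((Fin n → ι) → (Fin n → κ) → (Fin n → μ) → ℂ) → X} (hΨ : IsLinearMap ℂ Ψ)
    {u : (Fin n → ι) → (Fin n → κ) → (Fin n → μ) → ℂ} (h : Ψ u ≠ 0) :
    ∃ l : Nat.Partition n, Ψ (if θj = 0 then u else legIsotypicSum j l u) ≠ 0 := by
  by_cases hz : θj = 0
  · exact ⟨default, by rwa [if_pos hz]⟩
  simp only [if_neg hz]
  by_contra! hall
  apply h
  have hdec : ∑ l : Nat.Partition n,
      (spechtCharacter ℂ l 1 / (n.factorial : ℂ)) • legIsotypicSum j l u = u := by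
    match j with
    | 0 => simpa only [legIsotypicSum_zero] using (hC u).1
    | 1 => simpa only [legIsotypicSum_one] using (hC u).2.1
    | 2 => simpa only [legIsotypicSum_two] using (hC u).2.2
  calc Ψ u = Ψ (∑ l : Nat.Partition n,
        (spechtCharacter ℂ l 1 / (n.factorial : ℂ)) • legIsotypicSum j l u) := by rw [hdec]
    _ = ∑ l : Nat.Partition n,
        (spechtCharacter ℂ l 1 / (n.factorial : ℂ)) • Ψ (legIsotypicSum j l u) := by
      rw [← IsLinearMap.mk'_apply hΨ, map_sum]
      simp only [map_smul, IsLinearMap.mk'_apply]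
    _ = 0 := Finset.sum_eq_zero fun l _ => by rw [hall l, smul_zero]

/-- **(sw) ⇒ the first display of the proof of Lemma 3.13**: if a linear functional of `u` is
nonzero, it is nonzero on `(∏_{b ∈ supp θ} P_{μ^{(b)}}^{V_b}) u` for some tuple `μ⃗`
(`u = ∑_{μ⃗} ∏_b P_{μ^{(b)}} u`). [cite: ChristandlVranaZuiddam2023, Lemma 3.13 (proof)] -/
theorem exists_upperProjection_ne_zero (hC : sum_isotypicSum_eq_self.{u}) {n : ℕ} (θ : Fin 3 → ℝ)
    {X : Type*} [AddCommGroup X] [Module ℂ X]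
    {Ψ : ((Fin n → ι) → (Fin n → κ) → (Fin n → μ) → ℂ) → X} (hΨ : IsLinearMap ℂ Ψ)
    {u : (Fin n → ι) → (Fin n → κ) → (Fin n → μ) → ℂ} (h : Ψ u ≠ 0) :
    ∃ mu : Fin 3 → Nat.Partition n, Ψ (upperProjection θ mu u) ≠ 0 := by
  have hopt : ∀ (k : Fin 3) (l : Nat.Partition n), IsLinearMap ℂ
      (fun w : (Fin n → ι) → (Fin n → κ) → (Fin n → μ) → ℂ =>
        if θ k = 0 then w else legIsotypicSum k l w) := by
    intro k l
    split_ifs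
    exacts [⟨fun _ _ => rfl, fun _ _ => rfl⟩, isLinearMap_legIsotypicSum k l]
  obtain ⟨l₀, h₀⟩ := exists_legIsotypicSum_ne_zero hC (θ 0) 0 hΨ h
  obtain ⟨l₁, h₁⟩ := exists_legIsotypicSum_ne_zero hC (θ 1) 1 (isLinearMap_comp hΨ (hopt 0 l₀)) h₀
  obtain ⟨l₂, h₂⟩ := exists_legIsotypicSum_ne_zero hC (θ 2) 2
    (isLinearMap_comp (isLinearMap_comp hΨ (hopt 0 l₀)) (hopt 1 l₁)) h₁
  refine ⟨![l₀, l₁, l₂], ?_⟩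
  simpa only [upperProjection, legIsotypicSum_zero, legIsotypicSum_one, legIsotypicSum_two,
    Matrix.cons_val_zero, Matrix.cons_val_one, Matrix.cons_val_two, Matrix.head_cons,
    Matrix.tail_cons] using h₂

/-- **Displays (ee1) ⇒ `g ≠ 0`** of the proof of Lemma 3.13: if
`(∏_b P_{λ^{(b)}}^{(V⊗W)_b}) ((∏_b P_{μ^{(b)}}^{V_b} u) ⊗ (∏_b P_{ν^{(b)}}^{W_b} v)) ≠ 0`, then
`g_{λⱼ,μⱼ,νⱼ} ≠ 0` for every `j ∈ supp θ` (commute the other factors out, Lemma 3.2, and apply the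
Kronecker restriction rule). [cite: ChristandlVranaZuiddam2023, Lemma 3.13 (proof)] -/
theorem kroneckerCoeff_ne_zero_of_upperProjection_outerPow
    (hKR : kroneckerCoeff_ne_zero_of_isotypicSum_outerPow.{u}) {θ : Fin 3 → ℝ} {n : ℕ}
    {lam mu nu : Fin 3 → Nat.Partition n} {S : (Fin n → ι) → (Fin n → κ) → (Fin n → μ) → ℂ}
    {T : (Fin n → ι') → (Fin n → κ') → (Fin n → μ') → ℂ} {j : Fin 3} (hj : θ j ≠ 0)
    (h : upperProjection θ lam (outerPow (upperProjection θ mu S) (upperProjection θ nu T)) ≠ 0) :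
    kroneckerCoeff ℂ (mu j) (nu j) (lam j) ≠ 0 := by
  rw [upperProjection_eq_legIsotypicSum_comp hj lam, upperProjection_eq_legIsotypicSum_comp hj mu,
    upperProjection_eq_legIsotypicSum_comp hj nu,
    legIsotypicSum_upperProjection_comm (θ' := Function.update θ j 0)
      (Function.update_self j (0 : ℝ) θ) (lam j) lam] at h
  have h' : legIsotypicSum j (lam j) (outerPow
      (legIsotypicSum j (mu j) (upperProjection (Function.update θ j 0) mu S))
      (legIsotypicSum j (nu j) (upperProjection (Function.update θ j 0) nu T))) ≠ 0 := by
    intro h0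
    apply h
    rw [h0, upperProjection_zero]
  exact kroneckerCoeff_ne_zero_of_legIsotypicSum hKR j h'

/-- **Displays (ee1)–(ee3) of the proof of CVZ Lemma 3.13**: an admissible tuple `λ⃗` for `s ⊗ t`
at level `n` yields tuples `μ⃗`, `ν⃗ ⊢ n`, admissible for `s` and for `t` respectively, with
`g_{λⱼ,μⱼ,νⱼ} ≠ 0` for every `j ∈ supp θ` — given (sw) and the Kronecker restriction rule.
[cite: ChristandlVranaZuiddam2023, Lemma 3.13 (proof)] -/
theorem UpperAdmissible.exists_kronecker (hC : sum_isotypicSum_eq_self.{u})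
    (hKR : kroneckerCoeff_ne_zero_of_isotypicSum_outerPow.{u}) {θ : Fin 3 → ℝ}
    {s : ι → κ → μ → ℂ} {t : ι' → κ' → μ' → ℂ} {n : ℕ} {lam : Fin 3 → Nat.Partition n}
    (h : UpperAdmissible θ (kroneckerTensor s t) n lam) :
    ∃ mu nu : Fin 3 → Nat.Partition n, UpperAdmissible θ s n mu ∧ UpperAdmissible θ t n nu ∧
      ∀ j, θ j ≠ 0 → kroneckerCoeff ℂ (mu j) (nu j) (lam j) ≠ 0 := by
  unfold UpperAdmissible at h ⊢
  rw [kroneckerPow_kroneckerTensor] at h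
  obtain ⟨mu, hmu⟩ := exists_upperProjection_ne_zero hC θ
    (isLinearMap_comp (isLinearMap_upperProjection θ lam) (isLinearMap_outerPow_left (kroneckerPow t n)))
    h
  obtain ⟨nu, hnu⟩ := exists_upperProjection_ne_zero hC θ
    (isLinearMap_comp (isLinearMap_upperProjection θ lam)
      (isLinearMap_outerPow_right (upperProjection θ mu (kroneckerPow s n)))) hmu
  refine ⟨mu, nu, fun h0 => hnu ?_, fun h0 => hnu ?_, fun j hj => ?_⟩
  · rw [h0, outerPow_zero_left, upperProjection_zero]
  · rw [h0, outerPow_zero_right, upperProjection_zero]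
  · exact kroneckerCoeff_ne_zero_of_upperProjection_outerPow hKR hj hnu

/-- **Lemma 3.10.1 summed over `supp θ`**: if `g_{λⱼ,μⱼ,νⱼ} ≠ 0` for all `j` with `θ j ≠ 0` and
`θ ≥ 0`, then `∑ θⱼ H(λ̄ⱼ) ≤ ∑ θⱼ H(μ̄ⱼ) + ∑ θⱼ H(ν̄ⱼ)` (the display after (ee3) in the proof of
Lemma 3.13). [cite: ChristandlVranaZuiddam2023, Lemma 3.13 (proof)] -/
theorem weightedPartitionEntropy_le_add_of_kroneckerCoeff
    (hH : ChristandlVranaZuiddam2023_entropy_le_of_kroneckerCoeff) {θ : Fin 3 → ℝ}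
    (hθ : ∀ j, 0 ≤ θ j) {n : ℕ} {lam mu nu : Fin 3 → Nat.Partition n}
    (hg : ∀ j, θ j ≠ 0 → kroneckerCoeff ℂ (mu j) (nu j) (lam j) ≠ 0) :
    weightedPartitionEntropy θ lam ≤ weightedPartitionEntropy θ mu + weightedPartitionEntropy θ nu := by
  have key : ∀ j, θ j * partitionEntropy (lam j) ≤
      θ j * partitionEntropy (mu j) + θ j * partitionEntropy (nu j) := by
    intro j
    by_cases hj : θ j = 0
    · simp [hj]
    · rw [← mul_add]
      exact mul_le_mul_of_nonneg_left (hH _ _ _ (hg j hj)) (hθ j)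
  have k0 := key 0
  have k1 := key 1
  have k2 := key 2
  simp only [weightedPartitionEntropy]
  linarith

/-- **`E^θ(s ⊗ t) ≤ E^θ(s) + E^θ(t)`** (last sentence of the proof of CVZ Lemma 3.13), for
`θ ≥ 0`, from (sw), the Kronecker restriction rule, Lemma 3.10.1 and Schur–Weyl vanishing (the
latter only to know that the suprema `E^θ(s)`, `E^θ(t)` are over bounded sets).
[cite: ChristandlVranaZuiddam2023, Lemma 3.13] -/
theorem upperLogQuantumFunctional_kroneckerTensor_le (hSW : schurWeyl_isotypicSum_eq_zero.{u})
    (hC : sum_isotypicSum_eq_self.{u}) (hKR : kroneckerCoeff_ne_zero_of_isotypicSum_outerPow.{u})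
    (hH : ChristandlVranaZuiddam2023_entropy_le_of_kroneckerCoeff) {θ : Fin 3 → ℝ}
    (hθ : ∀ j, 0 ≤ θ j) (s : ι → κ → μ → ℂ) (t : ι' → κ' → μ' → ℂ) :
    upperLogQuantumFunctional θ (kroneckerTensor s t) ≤
      upperLogQuantumFunctional θ s + upperLogQuantumFunctional θ t := by
  refine Real.sSup_le ?_
    (add_nonneg (upperLogQuantumFunctional_nonneg hθ s) (upperLogQuantumFunctional_nonneg hθ t))
  rintro x ⟨n, lam, hn, hadm, rfl⟩
  obtain ⟨mu, nu, hmu, hnu, hg⟩ := hadm.exists_kronecker hC hKR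
  exact (weightedPartitionEntropy_le_add_of_kroneckerCoeff hH hθ hg).trans
    (add_le_add (weightedPartitionEntropy_le_upperLogQuantumFunctional hSW hθ hn hmu)
      (weightedPartitionEntropy_le_upperLogQuantumFunctional hSW hθ hn hnu))

end Proof

/-- **CVZ Lemma 3.13 from the printed ingredients**: sub-multiplicativity of the upper quantum
functional, `ChristandlVranaZuiddam2023_upper_submultiplicative` (`F^θ(s ⊗ t) ≤ F^θ(s) F^θ(t)` for
`θ ∈ P([3])`), follows from Schur–Weyl vanishing (finiteness of the suprema), the isotypic
decomposition (sw), the Kronecker restriction rule and the entropy inequality Lemma 3.10.1 — which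
is the printed proof. [cite: ChristandlVranaZuiddam2023, Lemma 3.13] -/
theorem ChristandlVranaZuiddam2023_upper_submultiplicative_of_schurWeyl
    (hSW : schurWeyl_isotypicSum_eq_zero.{u}) (hC : sum_isotypicSum_eq_self.{u})
    (hKR : kroneckerCoeff_ne_zero_of_isotypicSum_outerPow.{u})
    (hH : ChristandlVranaZuiddam2023_entropy_le_of_kroneckerCoeff) :
    ChristandlVranaZuiddam2023_upper_submultiplicative.{u} := by
  intro θ hθ ι κ μ ι' κ' μ' _ _ _ _ _ _ _ _ _ _ _ _ s t
  have hθ0 : ∀ j, 0 ≤ θ j := fun j => hθ.1 j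
  by_cases hst : kroneckerTensor s t = 0
  · rw [hst, upperQuantumFunctional_zero]
    exact mul_nonneg (upperQuantumFunctional_nonneg _ _) (upperQuantumFunctional_nonneg _ _)
  have hs : s ≠ 0 := by
    rintro rfl
    exact hst (funext fun a => funext fun b => funext fun c => by simp)
  have ht : t ≠ 0 := by
    rintro rfl
    exact hst (funext fun a => funext fun b => funext fun c => by simp)
  rw [upperQuantumFunctional_of_ne_zero θ hst, upperQuantumFunctional_of_ne_zero θ hs,
    upperQuantumFunctional_of_ne_zero θ ht, ← Real.rpow_add two_pos]
  exact Real.rpow_le_rpow_of_exponent_le one_le_two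
    (upperLogQuantumFunctional_kroneckerTensor_le hSW hC hKR hH hθ0 s t)

end Literature.Computability.AlgebraicComplexity

end
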